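import Summits.AtomisticToContinuum.BoseEinsteinCondensation.Theorems.BECStronglyRayleighLatticeToPeriodicBridgeMuffinTinWellPacking

/-!
# Route `BECStronglyRayleigh`, crux `LatticeToPeriodicBridge` (stmt-AtomisticToContinuum-9674),
# line `muffin-tin-reward-supermodularity` — WELL PACKING, one particle per well (the geometry of S2′)

Helper file of the crux line `muffin-tin-reward-supermodularity` (lead prover-line-stmt-AtomisticToContinuum-9674-c2-0,
`--supports stmt-AtomisticToContinuum-9674`), companion of `…MuffinTinWellPacking.lean` (dilute packing, many particles per
well). Here: ONE PARTICLE PER WELL — for a measurable profile `v` vanishing beyond `R₀`, wall fraction `0 < w < 1`, `M ≥ 1`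
periods of the torus of side `L > 0` whose wall slabs are at least as thick as the range (`R₀ ≤ w·L/M`) and `N ≤ M³`, some
periodic trial state lives in the wells (`⟨W⟩ = 0`) with finite periodic energy. This is exactly the geometry of S2′
(`DeepWellCondensateLimit`: `2R₀ < wL/M`, `N ≤ M³`), where it certifies that `E(λ,0) ≤ E_v[Φ] < ⊤` for EVERY wall height `λ`
(no `E = ⊤` corner; cf. the worker's audit in `…MuffinTinDeepWellDecomposition.lean`).

Construction: one Dirichlet bump per occupied well — a `SupportedState` on the union of `N` cells `subBox ℓ b d` (`b = L/M`,
`ℓ = (1-w)b`, corridor `R = wb ≥ R₀`) at distinct digits `d ∈ {0,…,M-1}³` has energy `≤ N·E₀^D(1,ℓ) < ⊤` (`infEnergy_biUnion_le`);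
translate it by the wall thickness `wb·(1,1,1)` into the wells, view it as a Dirichlet `TrialState N L`, periodise
(`TrialState.toPeriodic`). On the cell the periodised state is the translated Dirichlet state, which vanishes unless every particle
is in an open well cube, where `fract(Mx_k/L) ∈ (w,1)`: `⟨W⟩ = 0`. Its periodic energy is finite: translating back by `wb`
puts the support in `Λ_{L-wb}^N`, where the periodised interaction is the plain one (`periodicInteraction_eq_interaction_of_mem_boxN`,
`wb ≥ R₀`), and both interactions are translation invariant.

References: Ruelle 1969 §3.5.11; LSSY2005 Ch. 2 (periodisation).
-/

noncomputable section

namespace Summit.AtomisticToContinuum.BoseEinsteinCondensation.Cruxes.LatticeToPeriodicBridge.MuffinTinRewardSupermodularity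

open MeasureTheory Filter
open scoped ENNReal NNReal Topology
open Literature.MathematicalPhysics.QuantumManyBody.BoseGas
open Summit.AtomisticToContinuum.BoseEinsteinCondensation.Theses
open Summit.AtomisticToContinuum.BoseEinsteinCondensation.Theses.BECStronglyRayleigh

namespace DownSandwich

variable {N : ℕ} {L : ℝ}

/-- The periodic interaction is invariant under a common translation of all particles. [folklore] -/
theorem periodicInteraction_sub_const (v : ℝ → ℝ≥0∞) (L : ℝ) (X : Config N) (a : Space) :
    periodicInteraction v L (X - fun _ => a) = periodicInteraction v L X := by
  simp [periodicInteraction]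

/-- **Well packing (one particle per well).** For a measurable profile `v` vanishing beyond `R₀ ≥ 0`, wall
fraction `0 < w < 1`, `M ≥ 1` periods of the torus of side `L > 0` with wall slabs at least as thick as the range,
`R₀ ≤ w·L/M`, and `N ≤ M³` particles, there is a periodic trial state living in the wells (`⟨W⟩ = 0`) with finite
periodic energy: one Dirichlet bump per occupied well (Ruelle's subadditivity over separated sub-boxes), translated
into the wells and periodised. [folklore] -/
theorem exists_state_in_wells {v : ℝ → ℝ≥0∞} {R₀ : ℝ} (hv : Measurable v)
    (hvR : ∀ r, R₀ < r → v r = 0) {w : ℝ} (hw0 : 0 < w) (hw1 : w < 1) {M : ℕ} (hM : 0 < M) (hL : 0 < L)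
    (hwall : R₀ ≤ w * (L / M)) (hN : N ≤ M ^ 3) :
    ∃ Φ : PeriodicTrialState N L, wallEnergy N L M w Φ.ψ = 0 ∧ periodicEnergy v Φ ≠ ⊤ := by
  classical
  -- geometry
  set b : ℝ := L / M with hb
  have hM0 : (0 : ℝ) < M := by exact_mod_cast hM
  have hbpos : 0 < b := div_pos hL hM0
  set ℓ : ℝ := (1 - w) * b with hℓ
  set R : ℝ := w * b with hR
  have hℓpos : 0 < ℓ := mul_pos (by linarith) hbpos
  have hRnn : 0 ≤ R := by positivity
  have hℓR : ℓ + R = b := by rw [hℓ, hR]; ring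
  have hvR' : ∀ r, R < r → v r = 0 := fun r hr => hvR r (lt_of_le_of_lt hwall hr)
  have hLM : L = M * b := by rw [hb]; field_simp
  -- the wells' digits: an injection `Fin N ↪ (Fin 3 → Fin M)`
  let dg : Fin N → Fin 3 → ℕ := fun j k => ((finFunctionFinEquiv.symm (Fin.castLE hN j)) k : ℕ)
  have hdg_lt : ∀ j k, dg j k < M := fun j k => ((finFunctionFinEquiv.symm (Fin.castLE hN j)) k).isLt
  have hdg_inj : Function.Injective dg := by
    intro j j' h
    have h1 : finFunctionFinEquiv.symm (Fin.castLE hN j) = finFunctionFinEquiv.symm (Fin.castLE hN j') := by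
      funext k
      exact Fin.ext (congrFun h k)
    exact Fin.castLE_injective hN (finFunctionFinEquiv.symm.injective h1)
  -- the Dirichlet state on the union of the sub-boxes, with finite energy
  set U : Set Space := ⋃ j ∈ (Finset.univ : Finset (Fin N)), subBox ℓ (ℓ + R) (dg j) with hU
  have hinf : infEnergy v N U < ⊤ := by
    have h := infEnergy_biUnion_le (ℓ := ℓ) hv hvR' hRnn (Finset.univ : Finset (Fin N)) dg
      (fun j _ j' _ hne heq => hne (hdg_inj heq)) (fun _ => 1)
    simp only [Finset.sum_const, Finset.card_univ, Fintype.card_fin, smul_eq_mul, mul_one] at h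
    refine lt_of_le_of_lt h ?_
    refine ENNReal.sum_lt_top.2 fun j _ => ?_
    exact lt_of_le_of_lt (infEnergy_subBox_le_groundStateEnergy v 1 ℓ (ℓ + R) (dg j))
      (groundStateEnergy_one_lt_top v hℓpos)
  obtain ⟨Ψ, hΨ⟩ := iInf_lt_iff.1 hinf
  -- translate into the wells (shift by the wall thickness `R` along every axis)
  set a : Space := WithLp.toLp 2 (fun _ : Fin 3 => R) with ha
  set Ψa := Ψ.translate a with hΨa
  -- membership bookkeeping: `x - a ∈ U` puts `x` in an open well cube, inside the open box `Λ_L`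
  have hmemU : ∀ {x : Space}, x - a ∈ U → ∃ j, ∀ k,
      ((dg j k : ℝ) + w) * b < x k ∧ x k < ((dg j k : ℝ) + 1) * b := by
    intro x hx
    simp only [hU, Set.mem_iUnion, Finset.mem_univ, exists_true_left] at hx
    obtain ⟨j, hj⟩ := hx
    rw [mem_subBox] at hj
    refine ⟨j, fun k => ?_⟩
    have h1 := (hj k).1
    have h2 := (hj k).2
    have hxa : (x - a) k = x k - R := by simp [ha]
    rw [hxa, hℓR] at h1 h2
    constructor
    · calc ((dg j k : ℝ) + w) * b = b * (dg j k) + R := by rw [hR]; ring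
        _ < x k := by linarith
    · calc x k < b * (dg j k) + ℓ + R := by linarith
        _ = ((dg j k : ℝ) + 1) * b := by rw [hℓ, hR]; ring
  have hUbox : {x : Space | x - a ∈ U} ⊆ box L := by
    intro x hx k
    obtain ⟨j, hj⟩ := hmemU hx
    have h1 := (hj k).1
    have h2 := (hj k).2
    have hd0 : (0 : ℝ) ≤ dg j k := Nat.cast_nonneg _
    have hdM : (dg j k : ℝ) + 1 ≤ M := by exact_mod_cast hdg_lt j k
    constructor
    · have : 0 < ((dg j k : ℝ) + w) * b := by positivity
      linarith
    · calc x k < ((dg j k : ℝ) + 1) * b := h2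
        _ ≤ M * b := mul_le_mul_of_nonneg_right hdM hbpos.le
        _ = L := hLM.symm
  set ΨT : TrialState N L := (Ψa.mono hUbox).toTrialState with hΨT
  have hΨTψ : ΨT.ψ = Ψa.ψ := rfl
  have hEfin : energy v ΨT < ⊤ := by
    rw [energy_eq_rawEnergy, hΨTψ, hΨa, rawEnergy_translate]
    exact hΨ
  -- where the translated state is non-zero, every particle sits in an open well cube
  have hsupp : ∀ {X : Config N}, Ψa.ψ X ≠ 0 → ∀ i, X i - a ∈ U := by
    intro X hX i
    by_contra hi
    exact hX (Ψa.eq_zero X ⟨i, hi⟩)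
  -- the periodised state
  refine ⟨ΨT.toPeriodic hL le_rfl, ?_, ?_⟩
  · -- no wall mass
    change ∫⁻ X in cellN N L, wallCount M L w X * ((‖periodize L ΨT.ψ X‖₊ : ℝ≥0∞)) ^ 2 = 0
    refine (setLIntegral_congr_fun (measurableSet_cellN N L) fun X hX => ?_).trans lintegral_zero
    rw [periodize_of_mem_cellN hL _ hX, hΨTψ]
    by_cases hX0 : Ψa.ψ X = 0
    · simp [hX0]
    · have hW : wallCount M L w X = 0 := by
        unfold wallCount
        refine Finset.sum_eq_zero fun i _ => Finset.sum_eq_zero fun k _ => ?_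
        obtain ⟨j, hj⟩ := hmemU (hsupp hX0 i)
        have h1 := (hj k).1
        have h2 := (hj k).2
        have ht1 : (dg j k : ℝ) + w < (M : ℝ) * X i k / L := by
          rw [hLM, lt_div_iff₀ (by positivity)]
          calc ((dg j k : ℝ) + w) * (M * b) = M * (((dg j k : ℝ) + w) * b) := by ring
            _ < M * X i k := mul_lt_mul_of_pos_left h1 hM0
        have ht2 : (M : ℝ) * X i k / L < (dg j k : ℝ) + 1 := by
          rw [hLM, div_lt_iff₀ (by positivity)]
          calc (M : ℝ) * X i k < M * (((dg j k : ℝ) + 1) * b) := mul_lt_mul_of_pos_left h2 hM0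
            _ = ((dg j k : ℝ) + 1) * (M * b) := by ring
        rw [if_neg (not_fract_lt_of_mem hw0 ht1 ht2)]
      rw [hW, zero_mul]
  · -- finite periodic energy: on the support the image interactions vanish
    refine ne_top_of_le_ne_top hEfin.ne ?_
    unfold periodicEnergy energy
    have hL₀ : (L - R) + R ≤ L := by linarith
    have hpt : ∀ X, periodicInteraction v L X * ((‖Ψa.ψ X‖₊ : ℝ≥0∞)) ^ 2 =
        interaction v X * ((‖Ψa.ψ X‖₊ : ℝ≥0∞)) ^ 2 := by
      intro X
      by_cases hX0 : Ψa.ψ X = 0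
      · simp [hX0]
      · have hXa : (X - fun _ => a) ∈ boxN N (L - R) := by
          intro i k
          obtain ⟨j, hj⟩ := hmemU (hsupp hX0 i)
          have h1 := (hj k).1
          have h2 := (hj k).2
          have hd0 : (0 : ℝ) ≤ dg j k := Nat.cast_nonneg _
          have hdM : (dg j k : ℝ) + 1 ≤ M := by exact_mod_cast hdg_lt j k
          have hxa : ((X - fun _ : Fin N => a : Config N) i) k = X i k - R := by
            simp [ha]
          change (0 : ℝ) < ((X - fun _ : Fin N => a : Config N) i) k ∧
            ((X - fun _ : Fin N => a : Config N) i) k < L - R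
          rw [hxa]
          constructor
          · have : ((dg j k : ℝ) + w) * b = dg j k * b + R := by rw [hR]; ring
            nlinarith
          · calc X i k - R < ((dg j k : ℝ) + 1) * b - R := by linarith
              _ ≤ M * b - R := by nlinarith
              _ = L - R := by rw [hLM]
        rw [← periodicInteraction_sub_const v L X a,
          periodicInteraction_eq_interaction_of_mem_boxN hvR' hL hL₀ hXa, interaction_sub_const]
    calc ∫⁻ X in cellN N L, kineticDensity (ΨT.toPeriodic hL le_rfl).ψ X +
          periodicInteraction v L X * ((‖(ΨT.toPeriodic hL le_rfl).ψ X‖₊ : ℝ≥0∞)) ^ 2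
        = ∫⁻ X in boxN N L, kineticDensity (periodize L ΨT.ψ) X +
            periodicInteraction v L X * ((‖periodize L ΨT.ψ X‖₊ : ℝ≥0∞)) ^ 2 :=
          (setLIntegral_congr (boxN_ae_eq_cellN N L)).symm
      _ = ∫⁻ X in boxN N L, kineticDensity ΨT.ψ X + interaction v X * ((‖ΨT.ψ X‖₊ : ℝ≥0∞)) ^ 2 := by
          refine setLIntegral_congr_fun (measurableSet_boxN N L) fun X hX => ?_
          rw [kineticDensity_periodize_of_mem_boxN hL ΨT.ψ hX,
            periodize_of_mem_cellN hL ΨT.ψ (boxN_subset_cellN le_rfl hX), hΨTψ, hpt X]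
      _ ≤ _ := setLIntegral_le_lintegral _ _


end DownSandwich

/-- **Registered sub-goal `downSandwich_wellPackingOnePerWell`** (one particle per well, the geometry of S2′): for `R₀ ≤ w·L/M`
and `N ≤ M³` some periodic trial state lives in the wells of the muffin tin with finite periodic energy, so `E(λ,0) < ⊤` for every
wall height. [folklore] -/
theorem downSandwich_wellPackingOnePerWell :
    ∀ (v : ℝ → ENNReal) (R₀ : ℝ), Measurable v → (∀ r, R₀ < r → v r = 0) →
      ∀ (w : ℝ), 0 < w → w < 1 → ∀ (M : ℕ), 0 < M → ∀ (L : ℝ), 0 < L → R₀ ≤ w * (L / M) →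
        ∀ (N : ℕ), N ≤ M ^ 3 →
          ∃ Φ : PeriodicTrialState N L, wallEnergy N L M w Φ.ψ = 0 ∧ periodicEnergy v Φ ≠ ⊤ :=
  fun _ _ hv hvR _ hw0 hw1 _ hM _ hL hwall _ hN =>
    DownSandwich.exists_state_in_wells hv hvR hw0 hw1 hM hL hwall hN

end Summit.AtomisticToContinuum.BoseEinsteinCondensation.Cruxes.LatticeToPeriodicBridge.MuffinTinRewardSupermodularity

end
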